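import Literature.Analysis.FunctionSpaces.WightmanGNSContinuity
import Literature.Analysis.FunctionSpaces.WightmanGNSVacuum
import HarnessLib

/-!
# Wightman reconstruction: the GNS data satisfy the Wightman axioms

Streater–Wightman (1964), §3-4, Thm. 3-7 (existence part), assembled from the GNS
construction (`WightmanGNS`), its continuity properties (`WightmanGNSContinuity`) and the
uniqueness of the vacuum (`WightmanGNSVacuum`): the data `gnsData 𝒲 h𝒲` attached to a family
of tempered distributions `𝒲` with the properties (a)–(f) form a Wightman QFT on the polynomial
domain whose Wightman distributions are the `𝒲ₙ`, **given** the spectral condition of the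
reconstructed translation group (`GNSSpectralInput`, to be derived from (b); see the named fact
`GNS_spectral_condition`). The dimension restriction `d ≥ 1` enters through the uniqueness of
the vacuum (in `0 + 1` dimensions the cluster property (f) is vacuous and uniqueness fails for
mixtures, so `wightman_reconstruction_exists (d := 0)` is not provable as stated).

Main results:
* `gnsData` : the `WightmanData` of the reconstruction;
* `gnsData_isWightmanQFT` : W0–W4 given the spectral input;
* `gnsData_hasMinimalDomain`, `gnsData_isWightmanDistributionOf`;
* `wightman_reconstruction_exists_of_spectral` : the named fact
  `wightman_reconstruction_exists` (`WightmanFunctionsProofs`) for `d ≥ 1` from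
  `GNS_spectral_condition`.

## References
* R. F. Streater, A. S. Wightman, PCT, Spin and Statistics, and All That (1964), §3-4,
  Thm. 3-7.
-/

noncomputable section

open Filter Topology ComplexConjugate
open scoped InnerProductSpace SchwartzMap ComplexOrder

namespace Literature.Analysis.FunctionSpaces

namespace WightmanFamily

open Literature.MathematicalPhysics.QuantumLattice

namespace GNSSpace

variable {d : ℕ} {κ : Type} {𝒲 : WightmanFamily d κ} {h𝒲 : IsWightmanFamily 𝒲}

variable (𝒲 h𝒲) in
/-- The strongly continuous unitary representation of the translation group on the GNS Hilbert
space (Streater–Wightman (1964), §3-4 eq. (3-49) with `Λ = 1`). [cite: StreaterWightman1964, §3-4 eq. (3-49)] -/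
abbrev translRep : UnboundedOperators.UnitaryRep (Multiplicative (SpaceTime d)) (GNSHilbert 𝒲 h𝒲) where
  toMonoidHom := translHom 𝒲 h𝒲
  strongly_continuous := continuous_transl_apply
  mem_unitary := translHom_mem_unitary

/-- Unfolding of `translRep`. [folklore] -/
@[simp] theorem translRep_apply (a : Multiplicative (SpaceTime d)) (x : GNSHilbert 𝒲 h𝒲) :
    translRep 𝒲 h𝒲 a x = U 𝒲 h𝒲 (SemidirectProduct.inl a) x := rfl

variable (𝒲 h𝒲) in
/-- **The reconstructed Wightman data** (Streater–Wightman (1964), §3-4, Thm. 3-7): GNS Hilbert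
space, translations and Lorentz transformations `U(a, Λ)`, vacuum `Ω = [δ_{[]}]`, polynomial
domain `D₀` and the fields `φ_k(f) [v] = [(k,f) :: v]`. [cite: StreaterWightman1964, §3-4 Thm. 3-7] -/
abbrev gnsData : WightmanData d κ where
  H := GNSHilbert 𝒲 h𝒲
  transl := translRep 𝒲 h𝒲
  lor := lorHom 𝒲 h𝒲
  vacuum := vacuum 𝒲 h𝒲
  dom := dom 𝒲 h𝒲
  vacuum_mem := vacuum_mem_dom
  field := field 𝒲 h𝒲

/-- `U(g)` of the reconstructed data is the GNS operator `U 𝒲 h𝒲 g`. [folklore] -/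
theorem gnsData_U_apply (g : PoincareGroup d) (x : GNSHilbert 𝒲 h𝒲) :
    (gnsData 𝒲 h𝒲).U g x = U 𝒲 h𝒲 g x := by
  change U 𝒲 h𝒲 (SemidirectProduct.inl g.left) (U 𝒲 h𝒲 (SemidirectProduct.inr g.right) x) = _
  rw [← U_mul_apply, SemidirectProduct.inl_left_mul_inr_right]

/-- The field monomials of the reconstructed data are the GNS field monomials. [folklore] -/
theorem gnsData_fieldMonomial (l : Word d κ) :
    (gnsData 𝒲 h𝒲).fieldMonomial l = fieldMonomialOp 𝒲 h𝒲 l := by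
  induction l with
  | nil => rfl
  | cons p l ih =>
    rw [WightmanData.fieldMonomial_cons, fieldMonomialOp_cons, ih]
    rfl

/-- The vacuum of the reconstructed data as an element of the domain. [folklore] -/
theorem gnsData_vacuumDom : (gnsData 𝒲 h𝒲).vacuumDom = ⟨vacuum 𝒲 h𝒲, vacuum_mem_dom⟩ := rfl

variable (𝒲 h𝒲) in
/-- The spectral input: the reconstructed translation group has Fourier spectrum in the closed
forward cone (to be derived from property (b); Streater–Wightman (1964), §3-4, proof of Thm. 3-7, p. 110 (from (3-44))). [cite: StreaterWightman1964, §3-4, proof of Thm. 3-7, p. 110 (from (3-44))] -/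
def GNSSpectralInput : Prop := (translRep 𝒲 h𝒲).HasFourierSpectrumIn (closedForwardCone d)

/-- **The reconstructed data satisfy the Wightman axioms W0–W4** (Streater–Wightman (1964),
§3-4, Thm. 3-7), for `d ≥ 1` and given the spectral input. Real proof of all other clauses:
strong continuity (`continuous_lor_apply`, `continuous_transl_apply`), semidirect-product law
(`lor_transl`), uniqueness of the vacuum (`invariant_iff_mem_span_vacuum`), temperedness
(`continuous_inner_fieldOp`), hermiticity (`inner_fieldOp_hermitian`), covariance
(`U_fieldOp`), locality (`fieldOp_comm`), cyclicity (`dense_span_fieldMonomialOp`). [cite: StreaterWightman1964, §3-4 Thm. 3-7] -/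
theorem gnsData_isWightmanQFT [NeZero d] (hspec : GNSSpectralInput 𝒲 h𝒲) :
    IsWightmanQFT (gnsData 𝒲 h𝒲) where
  strongCont_lor := fun ψ => continuous_lor_apply ψ
  lor_transl := fun Λ a => lor_transl Λ a
  spectral := hspec
  uniqueVacuum := by
    refine ⟨⟨?_, ?_⟩, ?_⟩
    · rw [UnboundedOperators.UnitaryRep.mem_invariantVectors_iff]
      intro a
      change translHom 𝒲 h𝒲 a (vacuum 𝒲 h𝒲) = vacuum 𝒲 h𝒲
      rw [translHom_apply, U_vacuum]
    · intro h
      have := norm_vacuum (𝒲 := 𝒲) (h𝒲 := h𝒲)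
      rw [show (gnsData 𝒲 h𝒲).vacuum = vacuum 𝒲 h𝒲 from rfl] at h
      rw [h, norm_zero] at this
      exact zero_ne_one this
    · ext ψ
      rw [UnboundedOperators.UnitaryRep.mem_invariantVectors_iff]
      exact invariant_iff_mem_span_vacuum ψ
  lor_vacuum := fun Λ => by
    change U 𝒲 h𝒲 (SemidirectProduct.inr Λ) (vacuum 𝒲 h𝒲) = vacuum 𝒲 h𝒲
    exact U_vacuum _
  norm_vacuum := norm_vacuum
  dense_dom := dense_dom
  transl_dom := fun a ψ hψ => U_mem_dom _ hψ
  lor_dom := fun Λ ψ hψ => U_mem_dom _ hψ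
  tempered := fun k ψ χ => continuous_inner_fieldOp k ψ χ
  hermitian := fun k f ψ χ => inner_fieldOp_hermitian k f ψ χ
  covariant := fun g k f ψ hψ => by
    have hψ' : U 𝒲 h𝒲 g ψ ∈ dom 𝒲 h𝒲 := U_mem_dom g ψ.2
    have h1 : (⟨(gnsData 𝒲 h𝒲).U g ψ, hψ⟩ : dom 𝒲 h𝒲) = ⟨U 𝒲 h𝒲 g ψ, hψ'⟩ :=
      Subtype.ext (gnsData_U_apply g (ψ : GNSHilbert 𝒲 h𝒲))
    change (gnsData 𝒲 h𝒲).U g (fieldOp 𝒲 h𝒲 (k, f) ψ : GNSHilbert 𝒲 h𝒲) =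
      (fieldOp 𝒲 h𝒲 (k, poincareTest g f) ⟨(gnsData 𝒲 h𝒲).U g ψ, hψ⟩ : GNSHilbert 𝒲 h𝒲)
    rw [gnsData_U_apply, h1]
    exact U_fieldOp g k f ψ hψ'
  locality := fun k k' f g ψ h => fieldOp_comm k k' f g ψ h
  cyclic := by
    have h := dense_span_fieldMonomialOp (𝒲 := 𝒲) (h𝒲 := h𝒲)
    simp only [gnsData_fieldMonomial, gnsData_vacuumDom]
    exact h

/-- **The reconstructed data have minimal (polynomial) domain** `D = D₀`. [folklore] -/
theorem gnsData_hasMinimalDomain : (gnsData 𝒲 h𝒲).HasMinimalDomain := by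
  rw [WightmanData.HasMinimalDomain]
  simp only [gnsData_fieldMonomial, gnsData_vacuumDom]
  exact dom_eq_span

/-- **The Wightman distributions of the reconstructed data are the given `𝒲ₙ`**
(Streater–Wightman (1964), §3-4, Thm. 3-7 (statement)). [cite: StreaterWightman1964, §3-4, Thm. 3-7 (statement)] -/
theorem gnsData_isWightmanDistributionOf (n : ℕ) (k : Fin n → κ) :
    IsWightmanDistributionOf (gnsData 𝒲 h𝒲) n k (𝒲 n k) := by
  intro f F hF
  rw [WightmanData.wightmanFn, gnsData_fieldMonomial, gnsData_vacuumDom]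
  change _ = ⟪vacuum 𝒲 h𝒲, _⟫_ℂ
  rw [inner_vacuum_fieldMonomialOp, eval_ofFn 𝒲 k f hF]

end GNSSpace

end WightmanFamily

/-! ## The named fact and the reconstruction theorem for `d ≥ 1` -/

/-- **Spectral condition of the GNS translation group** (Streater–Wightman (1964), §3-4, proof
of Thm. 3-7, p. 110: "There remains only one property of `U(a, Λ)` to be verified, namely, that
its energy momentum spectrum lies in or on the future light cone. This is an immediate
consequence of (3-44)."): for every family `𝒲` with the properties (a)–(f), the strongly
continuous unitary translation group of the GNS Hilbert space has Fourier spectrum in the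
closed forward cone (`UnitaryRep.HasFourierSpectrumIn`). The derivation from (b) needs the
exchange of a tempered distribution with a Schwartz-weighted translation integral; stated here
as a named fact pending that lemma. Known theorem; proof deferred. [cite: StreaterWightman1964, §3-4, proof of Thm. 3-7, p. 110 (from (3-44))] -/
def GNS_spectral_condition : Prop :=
  ∀ (d : ℕ) (κ : Type) (𝒲 : WightmanFamily d κ) (h𝒲 : IsWightmanFamily 𝒲),
    WightmanFamily.GNSSpace.GNSSpectralInput 𝒲 h𝒲

/-- **Wightman reconstruction, existence (Streater–Wightman Thm. 3-7), for `d ≥ 1`, from the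
spectral fact**: the GNS data of a Wightman family are a Wightman QFT on the polynomial domain
with the given Wightman distributions. Real proof of everything except the spectral condition
of the translations (`GNS_spectral_condition`). [cite: StreaterWightman1964, §3-4 Thm. 3-7] -/
theorem wightman_reconstruction_exists_of_spectral {d : ℕ} [NeZero d]
    (hspec : GNS_spectral_condition) : wightman_reconstruction_exists (d := d) := by
  intro κ 𝒲 h𝒲
  exact ⟨WightmanFamily.GNSSpace.gnsData 𝒲 h𝒲,
    WightmanFamily.GNSSpace.gnsData_isWightmanQFT (hspec d κ 𝒲 h𝒲),
    WightmanFamily.GNSSpace.gnsData_hasMinimalDomain,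
    WightmanFamily.GNSSpace.gnsData_isWightmanDistributionOf⟩

end Literature.Analysis.FunctionSpaces
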